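import Summits.KontsevichZagierPeriods.KontsevichZagierPeriods.Theorems.RootDecompZetaThreeFrontierSupportCollapse

/-!
# Route RootDecompZetaThreeFrontier / RootDecompWeightFrontier — support collapse for item 27223 `HigherWeightDescent` — part 3/3 (`…SupportCollapseRung`): item 27223 `HigherWeightDescent` VERBATIM, its `ν ≤ 3` rung `HigherWeightDescentNuLeThree` HOLDS (`higherWeightDescent_nuLeThree`) and the saturated re-cut is EQUIVALENT (`saturated_iff`)

Theorems-split (3 files ≤ 400 lines, sequential imports) of the decomp-kz lens-1 gen-6 file
`run/shared/lean/pub/decomp-kz/decomp-kz-lens-1/g6/landing/RootDecompZetaThreeFrontierSupportCollapse.lean` (= SupportCollapse.lean @3ef2cb59,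
882 lines; lens farm rc 0 / 0 err / 0 warn / 0 sorry, standard axioms; critic decomp-kz-crit-1 g2 CLEARED 2026-08-30T06:31:48Z; landing ask L9 of the
writer), landed by the census seat decomp-kz-census-1 g6 (--supports stmt-KontsevichZagierPeriods-27223). Content: pole-free variables of a genus-zero
representation are ELIMINATED INSIDE the KZ calculus (rule-2 reindexing + ONE rule-3 Newton–Leibniz move over the band `lo < t < hi` with a RATIONAL
primitive), so the `ν ≤ 3` column of `HigherWeightDescent` (item 27223; all weights, all `k ≥ 4`) is a THEOREM and the item is EQUIVALENT to its
saturated re-cut. The Newton–Leibniz package of `…JanusBands.IntegrateOut` (item 3915; module unbuilt on the farm today) is carried as PRIVATE copies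
in part 2. [Kontsevich–Zagier 2001 §1.2] Standard axioms, 0 sorry.
-/

noncomputable section

set_option linter.dupNamespace false

open Set MeasureTheory MvPolynomial
open Literature.NumberTheory.Transcendental
open Literature.ModelTheory.ExponentialFields

namespace Summit.KontsevichZagierPeriods.KontsevichZagierPeriods.Theorems.RootDecompZetaThreeFrontierSupportCollapse

variable {k : ℕ}

open KZ in
/-- Item 27223 `HigherWeightDescent` of route RootDecompZetaThreeFrontier (born decl
`Summit.KontsevichZagierPeriods.KontsevichZagierPeriods.Theses.RootDecompZetaThreeFrontier.HigherWeightDescent`),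
VERBATIM (for reference and
for the rung below). -/
def HigherWeightDescent : Prop :=
  ∀ ⦃n k : ℕ⦄ (s : IntegralRep n) (g : IntegralRep k) (p : MvPolynomial (Fin k) ℚ)
    (a : Fin k → Fin k → ℕ) (b c : Fin k → ℕ), 4 ≤ k →
    ((n ≤ 2 ∧ s.IsRational) ∨ ∃ (p₀ : MvPolynomial (Fin n) ℚ) (a₀ : Fin n → Fin n → ℕ) (b₀ c₀ : Fin n → ℕ),
      s.domain = {t | (∀ i, 0 < t i) ∧ (∀ i, t i < 1) ∧ StrictAnti t} ∧
      EqOn s.integrand (fun t => (MvPolynomial.aeval t p₀ : ℝ) /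
        ((∏ i, t i ^ b₀ i) * (∏ i, (1 - t i) ^ c₀ i) * ∏ i, ∏ j, if i < j then (t i - t j) ^ a₀ i j else 1)) s.domain) →
    g.domain = {t | (∀ i, 0 < t i) ∧ (∀ i, t i < 1) ∧ StrictAnti t} →
    EqOn g.integrand (fun t => (MvPolynomial.aeval t p : ℝ) /
      ((∏ i, t i ^ b i) * (∏ i, (1 - t i) ^ c i) * ∏ i, ∏ j, if i < j then (t i - t j) ^ a i j else 1)) g.domain →
    s.value = g.value →
    ∃ (l l' : ℕ) (x : IntegralRep l) (x' : IntegralRep l'),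
      ((l ≤ 2 ∧ x.IsRational) ∨ (l ≤ 3 ∧ ∃ (p₁ : MvPolynomial (Fin l) ℚ) (a₁ : Fin l → Fin l → ℕ) (b₁ c₁ : Fin l → ℕ),
        x.domain = {t | (∀ i, 0 < t i) ∧ (∀ i, t i < 1) ∧ StrictAnti t} ∧
        EqOn x.integrand (fun t => (MvPolynomial.aeval t p₁ : ℝ) /
          ((∏ i, t i ^ b₁ i) * (∏ i, (1 - t i) ^ c₁ i) * ∏ i, ∏ j, if i < j then (t i - t j) ^ a₁ i j else 1)) x.domain)) ∧
      ((l' ≤ 2 ∧ x'.IsRational) ∨ (l' ≤ 3 ∧ ∃ (p₁ : MvPolynomial (Fin l') ℚ) (a₁ : Fin l' → Fin l' → ℕ) (b₁ c₁ : Fin l' → ℕ),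
        x'.domain = {t | (∀ i, 0 < t i) ∧ (∀ i, t i < 1) ∧ StrictAnti t} ∧
        EqOn x'.integrand (fun t => (MvPolynomial.aeval t p₁ : ℝ) /
          ((∏ i, t i ^ b₁ i) * (∏ i, (1 - t i) ^ c₁ i) * ∏ i, ∏ j, if i < j then (t i - t j) ^ a₁ i j else 1)) x'.domain)) ∧
      x.value = x'.value ∧ of s - of g - (of x - of x') ∈ relations

open KZ in
/-- **RUNG** (this generation): item 27223 RESTRICTED to the column `ν(g) ≤ 3` — at most three
variables of `g` carry poles (all weights, all dimensions `k ≥ 4`) — and, on the `s`-side, `s ∈ W₂` or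
`s` genus-zero with `ν(s) ≤ 3`. A literal restriction of the item (`nuLeThree_of_piece`) which HOLDS
(`higherWeightDescent_nuLeThree`). It contains the weight-zero rung of g5 (`ν = 0`) and the weight-one
column of the critic's score (`ν ≤ 2`). -/
def HigherWeightDescentNuLeThree : Prop :=
  ∀ ⦃n k : ℕ⦄ (s : IntegralRep n) (g : IntegralRep k) (p : MvPolynomial (Fin k) ℚ)
    (a : Fin k → Fin k → ℕ) (b c : Fin k → ℕ), 4 ≤ k →
    (∃ S : Finset (Fin k), S.card ≤ 3 ∧ ∀ i, i ∉ S →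
      b i = 0 ∧ c i = 0 ∧ ∀ j, (i < j → a i j = 0) ∧ (j < i → a j i = 0)) →
    ((n ≤ 2 ∧ s.IsRational) ∨ ∃ (p₀ : MvPolynomial (Fin n) ℚ) (a₀ : Fin n → Fin n → ℕ) (b₀ c₀ : Fin n → ℕ),
      (∃ S₀ : Finset (Fin n), S₀.card ≤ 3 ∧ ∀ i, i ∉ S₀ →
      b₀ i = 0 ∧ c₀ i = 0 ∧ ∀ j, (i < j → a₀ i j = 0) ∧ (j < i → a₀ j i = 0)) ∧
      s.domain = {t | (∀ i, 0 < t i) ∧ (∀ i, t i < 1) ∧ StrictAnti t} ∧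
      EqOn s.integrand (fun t => (MvPolynomial.aeval t p₀ : ℝ) /
        ((∏ i, t i ^ b₀ i) * (∏ i, (1 - t i) ^ c₀ i) * ∏ i, ∏ j, if i < j then (t i - t j) ^ a₀ i j else 1)) s.domain) →
    g.domain = {t | (∀ i, 0 < t i) ∧ (∀ i, t i < 1) ∧ StrictAnti t} →
    EqOn g.integrand (fun t => (MvPolynomial.aeval t p : ℝ) /
      ((∏ i, t i ^ b i) * (∏ i, (1 - t i) ^ c i) * ∏ i, ∏ j, if i < j then (t i - t j) ^ a i j else 1)) g.domain →
    s.value = g.value →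
    ∃ (l l' : ℕ) (x : IntegralRep l) (x' : IntegralRep l'),
      ((l ≤ 2 ∧ x.IsRational) ∨ (l ≤ 3 ∧ ∃ (p₁ : MvPolynomial (Fin l) ℚ) (a₁ : Fin l → Fin l → ℕ) (b₁ c₁ : Fin l → ℕ),
        x.domain = {t | (∀ i, 0 < t i) ∧ (∀ i, t i < 1) ∧ StrictAnti t} ∧
        EqOn x.integrand (fun t => (MvPolynomial.aeval t p₁ : ℝ) /
          ((∏ i, t i ^ b₁ i) * (∏ i, (1 - t i) ^ c₁ i) * ∏ i, ∏ j, if i < j then (t i - t j) ^ a₁ i j else 1)) x.domain)) ∧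
      ((l' ≤ 2 ∧ x'.IsRational) ∨ (l' ≤ 3 ∧ ∃ (p₁ : MvPolynomial (Fin l') ℚ) (a₁ : Fin l' → Fin l' → ℕ) (b₁ c₁ : Fin l' → ℕ),
        x'.domain = {t | (∀ i, 0 < t i) ∧ (∀ i, t i < 1) ∧ StrictAnti t} ∧
        EqOn x'.integrand (fun t => (MvPolynomial.aeval t p₁ : ℝ) /
          ((∏ i, t i ^ b₁ i) * (∏ i, (1 - t i) ^ c₁ i) * ∏ i, ∏ j, if i < j then (t i - t j) ^ a₁ i j else 1)) x'.domain)) ∧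
      x.value = x'.value ∧ of s - of g - (of x - of x') ∈ relations

open KZ in
/-- **RE-CUT** (this generation): item 27223 RESTRICTED to SATURATED data — every variable of `g`
carries a pole, and `s ∈ W₂` or `s` is saturated genus-zero. A literal restriction of the item which is
EQUIVALENT to it (`saturated_iff`): pole-free variables are eliminated inside the calculus first. -/
def HigherWeightDescentSaturated : Prop :=
  ∀ ⦃n k : ℕ⦄ (s : IntegralRep n) (g : IntegralRep k) (p : MvPolynomial (Fin k) ℚ)
    (a : Fin k → Fin k → ℕ) (b c : Fin k → ℕ), 4 ≤ k →
    (∀ i, b i ≠ 0 ∨ c i ≠ 0 ∨ ∃ j, (i < j ∧ a i j ≠ 0) ∨ (j < i ∧ a j i ≠ 0)) →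
    ((n ≤ 2 ∧ s.IsRational) ∨ ∃ (p₀ : MvPolynomial (Fin n) ℚ) (a₀ : Fin n → Fin n → ℕ) (b₀ c₀ : Fin n → ℕ),
      (∀ i, b₀ i ≠ 0 ∨ c₀ i ≠ 0 ∨ ∃ j, (i < j ∧ a₀ i j ≠ 0) ∨ (j < i ∧ a₀ j i ≠ 0)) ∧
      s.domain = {t | (∀ i, 0 < t i) ∧ (∀ i, t i < 1) ∧ StrictAnti t} ∧
      EqOn s.integrand (fun t => (MvPolynomial.aeval t p₀ : ℝ) /
        ((∏ i, t i ^ b₀ i) * (∏ i, (1 - t i) ^ c₀ i) * ∏ i, ∏ j, if i < j then (t i - t j) ^ a₀ i j else 1)) s.domain) →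
    g.domain = {t | (∀ i, 0 < t i) ∧ (∀ i, t i < 1) ∧ StrictAnti t} →
    EqOn g.integrand (fun t => (MvPolynomial.aeval t p : ℝ) /
      ((∏ i, t i ^ b i) * (∏ i, (1 - t i) ^ c i) * ∏ i, ∏ j, if i < j then (t i - t j) ^ a i j else 1)) g.domain →
    s.value = g.value →
    ∃ (l l' : ℕ) (x : IntegralRep l) (x' : IntegralRep l'),
      ((l ≤ 2 ∧ x.IsRational) ∨ (l ≤ 3 ∧ ∃ (p₁ : MvPolynomial (Fin l) ℚ) (a₁ : Fin l → Fin l → ℕ) (b₁ c₁ : Fin l → ℕ),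
        x.domain = {t | (∀ i, 0 < t i) ∧ (∀ i, t i < 1) ∧ StrictAnti t} ∧
        EqOn x.integrand (fun t => (MvPolynomial.aeval t p₁ : ℝ) /
          ((∏ i, t i ^ b₁ i) * (∏ i, (1 - t i) ^ c₁ i) * ∏ i, ∏ j, if i < j then (t i - t j) ^ a₁ i j else 1)) x.domain)) ∧
      ((l' ≤ 2 ∧ x'.IsRational) ∨ (l' ≤ 3 ∧ ∃ (p₁ : MvPolynomial (Fin l') ℚ) (a₁ : Fin l' → Fin l' → ℕ) (b₁ c₁ : Fin l' → ℕ),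
        x'.domain = {t | (∀ i, 0 < t i) ∧ (∀ i, t i < 1) ∧ StrictAnti t} ∧
        EqOn x'.integrand (fun t => (MvPolynomial.aeval t p₁ : ℝ) /
          ((∏ i, t i ^ b₁ i) * (∏ i, (1 - t i) ^ c₁ i) * ∏ i, ∏ j, if i < j then (t i - t j) ^ a₁ i j else 1)) x'.domain)) ∧
      x.value = x'.value ∧ of s - of g - (of x - of x') ∈ relations

open KZ in
/-- The critic's score (b), first half: item 27223 with `g = [Δ_k, P(t)/tᵢ]` (ONE simple pole `tᵢ`, the
log layer), `s ∈ W₂`. A literal instance of the item (`weightOnePole_of_piece`) which HOLDS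
(`higherWeightDescent_weightOnePole`, from the `ν ≤ 3` rung with `S = {i}`). -/
def HigherWeightDescentWeightOnePole : Prop :=
  ∀ ⦃n k : ℕ⦄ (s : IntegralRep n) (g : IntegralRep k) (p : MvPolynomial (Fin k) ℚ) (i : Fin k), 4 ≤ k →
    (n ≤ 2 ∧ s.IsRational) →
    g.domain = {t | (∀ i, 0 < t i) ∧ (∀ i, t i < 1) ∧ StrictAnti t} →
    EqOn g.integrand (fun t => (MvPolynomial.aeval t p : ℝ) /
      ((∏ j, t j ^ (Pi.single i 1 : Fin k → ℕ) j) * (∏ j, (1 - t j) ^ (0 : ℕ)) * ∏ j, ∏ j', if j < j' then (t j - t j') ^ (0 : ℕ) else 1)) g.domain →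
    s.value = g.value →
    ∃ (l l' : ℕ) (x : IntegralRep l) (x' : IntegralRep l'),
      ((l ≤ 2 ∧ x.IsRational) ∨ (l ≤ 3 ∧ ∃ (p₁ : MvPolynomial (Fin l) ℚ) (a₁ : Fin l → Fin l → ℕ) (b₁ c₁ : Fin l → ℕ),
        x.domain = {t | (∀ i, 0 < t i) ∧ (∀ i, t i < 1) ∧ StrictAnti t} ∧
        EqOn x.integrand (fun t => (MvPolynomial.aeval t p₁ : ℝ) /
          ((∏ i, t i ^ b₁ i) * (∏ i, (1 - t i) ^ c₁ i) * ∏ i, ∏ j, if i < j then (t i - t j) ^ a₁ i j else 1)) x.domain)) ∧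
      ((l' ≤ 2 ∧ x'.IsRational) ∨ (l' ≤ 3 ∧ ∃ (p₁ : MvPolynomial (Fin l') ℚ) (a₁ : Fin l' → Fin l' → ℕ) (b₁ c₁ : Fin l' → ℕ),
        x'.domain = {t | (∀ i, 0 < t i) ∧ (∀ i, t i < 1) ∧ StrictAnti t} ∧
        EqOn x'.integrand (fun t => (MvPolynomial.aeval t p₁ : ℝ) /
          ((∏ i, t i ^ b₁ i) * (∏ i, (1 - t i) ^ c₁ i) * ∏ i, ∏ j, if i < j then (t i - t j) ^ a₁ i j else 1)) x'.domain)) ∧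
      x.value = x'.value ∧ of s - of g - (of x - of x') ∈ relations

open KZ in
/-- The critic's score (b), second half: the same with the simple pole `1 - tᵢ`. -/
def HigherWeightDescentWeightOneCoPole : Prop :=
  ∀ ⦃n k : ℕ⦄ (s : IntegralRep n) (g : IntegralRep k) (p : MvPolynomial (Fin k) ℚ) (i : Fin k), 4 ≤ k →
    (n ≤ 2 ∧ s.IsRational) →
    g.domain = {t | (∀ i, 0 < t i) ∧ (∀ i, t i < 1) ∧ StrictAnti t} →
    EqOn g.integrand (fun t => (MvPolynomial.aeval t p : ℝ) /
      ((∏ j, t j ^ (0 : ℕ)) * (∏ j, (1 - t j) ^ (Pi.single i 1 : Fin k → ℕ) j) * ∏ j, ∏ j', if j < j' then (t j - t j') ^ (0 : ℕ) else 1)) g.domain →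
    s.value = g.value →
    ∃ (l l' : ℕ) (x : IntegralRep l) (x' : IntegralRep l'),
      ((l ≤ 2 ∧ x.IsRational) ∨ (l ≤ 3 ∧ ∃ (p₁ : MvPolynomial (Fin l) ℚ) (a₁ : Fin l → Fin l → ℕ) (b₁ c₁ : Fin l → ℕ),
        x.domain = {t | (∀ i, 0 < t i) ∧ (∀ i, t i < 1) ∧ StrictAnti t} ∧
        EqOn x.integrand (fun t => (MvPolynomial.aeval t p₁ : ℝ) /
          ((∏ i, t i ^ b₁ i) * (∏ i, (1 - t i) ^ c₁ i) * ∏ i, ∏ j, if i < j then (t i - t j) ^ a₁ i j else 1)) x.domain)) ∧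
      ((l' ≤ 2 ∧ x'.IsRational) ∨ (l' ≤ 3 ∧ ∃ (p₁ : MvPolynomial (Fin l') ℚ) (a₁ : Fin l' → Fin l' → ℕ) (b₁ c₁ : Fin l' → ℕ),
        x'.domain = {t | (∀ i, 0 < t i) ∧ (∀ i, t i < 1) ∧ StrictAnti t} ∧
        EqOn x'.integrand (fun t => (MvPolynomial.aeval t p₁ : ℝ) /
          ((∏ i, t i ^ b₁ i) * (∏ i, (1 - t i) ^ c₁ i) * ∏ i, ∏ j, if i < j then (t i - t j) ^ a₁ i j else 1)) x'.domain)) ∧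
      x.value = x'.value ∧ of s - of g - (of x - of x') ∈ relations

/-- The rung is a LITERAL RESTRICTION of the item. -/
theorem nuLeThree_of_piece (h : HigherWeightDescent) : HigherWeightDescentNuLeThree := by
  intro n k s g p a b c hk _ hs hgd hgi hv
  rcases hs with hsW | ⟨p₀, a₀, b₀, c₀, -, hsd, hsi⟩
  · exact h s g p a b c hk (Or.inl hsW) hgd hgi hv
  · exact h s g p a b c hk (Or.inr ⟨p₀, a₀, b₀, c₀, hsd, hsi⟩) hgd hgi hv

/-- **The `ν ≤ 3` rung of item 27223 HOLDS** (all weights, all dimensions): collapse `g` (and `s`, if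
it is genus-zero) onto its singular variables; `x := s` or `s↓`, `x' := g↓`. All the work is on the
`g`-side; `x := s` is the free side exactly when `s ∈ W₂`. -/
theorem higherWeightDescent_nuLeThree : HigherWeightDescentNuLeThree := by
  intro n k s g p a b c hk hS hs hgd hgi hv
  obtain ⟨S, hS3, hS⟩ := hS
  obtain ⟨l', x', p₁', a₁', b₁', c₁', hl', -, hx'd, hx'i, hx'v, hgx'⟩ :=
    collapse_literal g p a b c S hS hgd hgi
  rcases hs with hsW | ⟨p₀, a₀, b₀, c₀, ⟨S₀, hS₀3, hS₀⟩, hsd, hsi⟩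
  · refine ⟨n, l', s, x', Or.inl hsW, Or.inr ⟨hl'.trans hS3, p₁', a₁', b₁', c₁', hx'd, hx'i⟩,
      by rw [hx'v]; exact hv, ?_⟩
    have e : KZ.of s - KZ.of g - (KZ.of s - KZ.of x') = -(KZ.of g - KZ.of x') := by abel
    rw [e]
    exact KZ.relations.neg_mem hgx'
  · obtain ⟨l, x, p₁, a₁, b₁, c₁, hl, -, hxd, hxi, hxv, hsx⟩ :=
      collapse_literal s p₀ a₀ b₀ c₀ S₀ hS₀ hsd hsi
    refine ⟨l, l', x, x', Or.inr ⟨hl.trans hS₀3, p₁, a₁, b₁, c₁, hxd, hxi⟩,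
      Or.inr ⟨hl'.trans hS3, p₁', a₁', b₁', c₁', hx'd, hx'i⟩, by rw [hxv, hx'v]; exact hv, ?_⟩
    have e : KZ.of s - KZ.of g - (KZ.of x - KZ.of x') =
        (KZ.of s - KZ.of x) - (KZ.of g - KZ.of x') := by abel
    rw [e]
    exact KZ.relations.sub_mem hsx hgx'

/-- The saturated re-cut is a LITERAL RESTRICTION of the item. -/
theorem saturated_of_piece (h : HigherWeightDescent) : HigherWeightDescentSaturated := by
  intro n k s g p a b c hk _ hs hgd hgi hv
  rcases hs with hsW | ⟨p₀, a₀, b₀, c₀, -, hsd, hsi⟩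
  · exact h s g p a b c hk (Or.inl hsW) hgd hgi hv
  · exact h s g p a b c hk (Or.inr ⟨p₀, a₀, b₀, c₀, hsd, hsi⟩) hgd hgi hv

open KZ in
/-- **… and it implies the item back**: WLOG every variable of `g` and of `s` carries a pole. -/
theorem piece_of_saturated (h : HigherWeightDescentSaturated) : HigherWeightDescent := by
  classical
  intro n k s g p a b c hk hs hgd hgi hv
  -- collapse `g` onto its singular variables
  obtain ⟨l', g₁, q₁, a₁, b₁, c₁, -, hsat₁, hg₁d, hg₁i, hg₁v, hgg₁⟩ :=
    collapse_literal g p a b c (Finset.univ.filter fun i => Singular a b c i)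
      (fun i hi => not_singular_iff.mp (by simpa using hi)) hgd hgi
  -- normalise `s`: either `s ∈ W₂` (keep it) or collapse it onto its singular variables
  have hs' : ∃ (m : ℕ) (s₁ : IntegralRep m),
      ((m ≤ 2 ∧ s₁.IsRational) ∨ ∃ (p₀ : MvPolynomial (Fin m) ℚ) (a₀ : Fin m → Fin m → ℕ) (b₀ c₀ : Fin m → ℕ),
        (∀ i, b₀ i ≠ 0 ∨ c₀ i ≠ 0 ∨ ∃ j, (i < j ∧ a₀ i j ≠ 0) ∨ (j < i ∧ a₀ j i ≠ 0)) ∧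
        s₁.domain = {t | (∀ i, 0 < t i) ∧ (∀ i, t i < 1) ∧ StrictAnti t} ∧
        EqOn s₁.integrand (fun t => (MvPolynomial.aeval t p₀ : ℝ) /
          ((∏ i, t i ^ b₀ i) * (∏ i, (1 - t i) ^ c₀ i) * ∏ i, ∏ j, if i < j then (t i - t j) ^ a₀ i j else 1)) s₁.domain) ∧
      s₁.value = s.value ∧ of s - of s₁ ∈ relations := by
    rcases hs with hsW | ⟨p₀, a₀, b₀, c₀, hsd, hsi⟩
    · exact ⟨n, s, Or.inl hsW, rfl, by rw [sub_self]; exact relations.zero_mem⟩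
    · obtain ⟨m, s₁, p₂, a₂, b₂, c₂, -, hsat₂, hs₁d, hs₁i, hs₁v, hss₁⟩ :=
        collapse_literal s p₀ a₀ b₀ c₀ (Finset.univ.filter fun i => Singular a₀ b₀ c₀ i)
          (fun i hi => not_singular_iff.mp (by simpa using hi)) hsd hsi
      exact ⟨m, s₁, Or.inr ⟨p₂, a₂, b₂, c₂, hsat₂, hs₁d, hs₁i⟩, hs₁v, hss₁⟩
  obtain ⟨m, s₁, hs₁, hs₁v, hss₁⟩ := hs'
  have hv₁ : s₁.value = g₁.value := by rw [hs₁v, hg₁v]; exact hv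
  by_cases hl' : 4 ≤ l'
  · -- the saturated statement applies to `(s₁, g₁)` directly
    obtain ⟨l, l'', x, x', hx, hx', hxv, hrel⟩ := h s₁ g₁ q₁ a₁ b₁ c₁ hl' hsat₁ hs₁ hg₁d hg₁i hv₁
    exact ⟨l, l'', x, x', hx, hx', hxv, transport hss₁ hgg₁ hrel⟩
  · have hl3 : l' ≤ 3 := by omega
    rcases hs₁ with hs₁W | ⟨p₀, a₀, b₀, c₀, hsat₀, hs₁d, hs₁i⟩
    · -- `s₁ ∈ W₂`, `g₁ ∈ GZ_{≤3}`: done with `x := s₁`, `x' := g₁`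
      refine ⟨m, l', s₁, g₁, Or.inl hs₁W, Or.inr ⟨hl3, q₁, a₁, b₁, c₁, hg₁d, hg₁i⟩, hv₁,
        transport hss₁ hgg₁ ?_⟩
      rw [sub_self]
      exact relations.zero_mem
    · by_cases hm : 4 ≤ m
      · -- roles swapped: `g₁` (small, genus-zero) is the `s`-side, `s₁` (saturated, `m ≥ 4`) the `g`-side
        obtain ⟨l, l'', x, x', hx, hx', hxv, hrel⟩ :=
          h g₁ s₁ p₀ a₀ b₀ c₀ hm hsat₀ (Or.inr ⟨q₁, a₁, b₁, c₁, hsat₁, hg₁d, hg₁i⟩) hs₁d hs₁i hv₁.symm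
        refine ⟨l'', l, x', x, hx', hx, hxv.symm, transport hss₁ hgg₁ ?_⟩
        have e : of s₁ - of g₁ - (of x' - of x) = -(of g₁ - of s₁ - (of x - of x')) := by abel
        rw [e]
        exact relations.neg_mem hrel
      · refine ⟨m, l', s₁, g₁, Or.inr ⟨by omega, p₀, a₀, b₀, c₀, hs₁d, hs₁i⟩,
          Or.inr ⟨hl3, q₁, a₁, b₁, c₁, hg₁d, hg₁i⟩, hv₁, transport hss₁ hgg₁ ?_⟩
        rw [sub_self]
        exact relations.zero_mem

/-- **Item 27223 ⟺ its saturated re-cut.** -/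
theorem saturated_iff : HigherWeightDescentSaturated ↔ HigherWeightDescent :=
  ⟨piece_of_saturated, saturated_of_piece⟩

/-- The weight-one (pole `tᵢ`) statement is a LITERAL INSTANCE of the item. -/
theorem weightOnePole_of_piece (h : HigherWeightDescent) : HigherWeightDescentWeightOnePole :=
  fun _ _ s g p i hk hs hgd hgi hv =>
    h s g p (fun _ _ => 0) (Pi.single i 1) (fun _ => 0) hk (Or.inl hs) hgd hgi hv

/-- The weight-one (pole `1 - tᵢ`) statement is a LITERAL INSTANCE of the item. -/
theorem weightOneCoPole_of_piece (h : HigherWeightDescent) : HigherWeightDescentWeightOneCoPole :=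
  fun _ _ s g p i hk hs hgd hgi hv =>
    h s g p (fun _ _ => 0) (fun _ => 0) (Pi.single i 1) hk (Or.inl hs) hgd hgi hv

/-- Helper (theorem) `free_of_single` of the support-collapse chain for item 27223 (lens-1 g6). -/
theorem free_of_single {k : ℕ} (i : Fin k) :
    ∀ j : Fin k, j ∉ ({i} : Finset (Fin k)) → (Pi.single i 1 : Fin k → ℕ) j = 0 := by
  intro j hj
  rw [Finset.mem_singleton] at hj
  exact Pi.single_eq_of_ne hj _

/-- **The weight-one rung (pole `tᵢ`) HOLDS.** -/
theorem higherWeightDescent_weightOnePole : HigherWeightDescentWeightOnePole :=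
  fun _ _ s g p i hk hs hgd hgi hv =>
    higherWeightDescent_nuLeThree s g p (fun _ _ => 0) (Pi.single i 1) (fun _ => 0) hk
      ⟨{i}, by simp, fun j hj => ⟨free_of_single i j hj, rfl, fun _ => ⟨fun _ => rfl, fun _ => rfl⟩⟩⟩
      (Or.inl hs) hgd hgi hv

/-- **The weight-one rung (pole `1 - tᵢ`) HOLDS.** -/
theorem higherWeightDescent_weightOneCoPole : HigherWeightDescentWeightOneCoPole :=
  fun _ _ s g p i hk hs hgd hgi hv =>
    higherWeightDescent_nuLeThree s g p (fun _ _ => 0) (fun _ => 0) (Pi.single i 1) hk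
      ⟨{i}, by simp, fun j hj => ⟨rfl, free_of_single i j hj, fun _ => ⟨fun _ => rfl, fun _ => rfl⟩⟩⟩
      (Or.inl hs) hgd hgi hv

end Summit.KontsevichZagierPeriods.KontsevichZagierPeriods.Theorems.RootDecompZetaThreeFrontierSupportCollapse
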